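import Summits.AtomisticToContinuum.Crystallization.Theorems.FrustratedLawDichotomyStrainedPatchHomExteriorPieces

/-!
# Strained patch, `(H)` hcp exterior certificate (architecture R3, critic rows 1470–1472) — E3 GEOMETRIC CORE: the BREAK POINTS `θ_k` of the ray `ξ₀ + s·(ξ − ξ₀)`
# through a NESTED CHAIN OF CLOSED BOXES exist, with both ray points of each piece inside its box (decomp-a2c hand 2, generation 39; structural #8)

`…HomExteriorPieces.hver_of_slabParts_pieces` (hand-1 g39, p854078) takes break points `θ : ℕ → ℝ` (`θ 0 = 0`, `θ m = 1`, monotone) and per-piece floors `ℓ k` valid on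
`(θ k, θ (k+1))`; the floors come from `…HomCurvLJAnisoM.curvLJ_floorM_of_check` on a box `B_k`, which needs BOTH ray points `ξ₀ + θ k·(ξ − ξ₀)` and `ξ₀ + θ (k+1)·(ξ − ξ₀)`
inside `B_k` (then `…HomExteriorChain.floor_transport` rescales the piece to `(θ k, θ (k+1))`).  RING-LEAF-SPEC rev 6 §8 / critic row 1472 (A) E3 recipe: «for nested boxes
`θ_k` = the parameter where the ray leaves `B_k`».  This module proves that recipe ONCE, for every `(ξ₀, ξ)`, from SET-LEVEL data only:

* §1 (any real normed space) `raySet ξ₀ ξ B = {s ∈ [0,1] | ξ₀ + s·(ξ − ξ₀) ∈ B}` is closed and bounded for closed `B`, contains `0` when `ξ₀ ∈ B`, so its `sSup` is ATTAINED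
  (`IsClosed.csSup_mem`); `exitParam` = the break points; ★ `exists_exitChain`: for closed `B 0 ⊆ B 1 ⊆ … ⊆ B (m−1)` with `ξ₀ ∈ B 0` and `ξ ∈ B (m−1)` there are
  `θ 0 = 0 ≤ θ 1 ≤ … ≤ θ m = 1` in `[0,1]` with `ξ₀ + θ k·(ξ − ξ₀) ∈ B k` and `ξ₀ + θ (k+1)·(ξ − ξ₀) ∈ B k` for every `k < m` — NO convexity or box structure needed, only
  closedness and nesting (the exterior boxes of a column are nested around the cell's reference box by construction; the annulus chain (β) is handled by taking
  `B k` := the union of the first `k+1` annulus boxes with the core chain, still nested and closed).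
* §2 (the kit's coordinates) `xiBox c w = {x : E3 | ∀ i, |x i − c (inr i)/SC| ≤ w (inr i)/SC}` is closed; integer endpoint containment ⇒ `xiBox c w ⊆ xiBox c' w'`
  (`xiBox_mono`, the side condition a manifest/Bool verdict checks by `decide`); ★ `exists_exitChain_xiBox`: the break points for a chain of integer ξ-boxes
  `(cs k, ws k)`, `k < m`, delivered EXACTLY in the hypothesis shape of `curvLJ_floorM_of_check` (`∀ i, |(ray point) i − c/SC| ≤ w/SC`) and of
  `hver_of_slabParts_pieces` (`hθ0`, `hθm`, `hmono`).

What E3 still needs after this file (successor hand-1 / hand-2, per critic row 1472 (A)): the Bool `exteriorOK` (fields: cell box, the box chain `(cs, ws)`, the kernel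
`curvCheckLJM` facts per box, the integer containments, and the REGION-MINIMUM inequality (s2) for `Λ·‖UΔ‖ > S₇♯ + f₀ + |R|·6⁻⁷` over the slab), its soundness by
`hver_of_slabParts_pieces` ∘ this file ∘ `floor_transport` ∘ `curvLJ_floorM_of_check`, and the column fold `semOKH_of_cutOK_leaves` (`…HomCutTreeLeaves`, p854068).
One `def` of a set (`raySet`), one of the break-point function (`exitParam`), one of the coordinate box (`xiBox`); 0 sorry; standard axioms.  `--supports stmt-AtomisticToContinuum-27623`.
[formal bookkeeping + folklore real analysis]
-/

noncomputable section

open Set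

namespace Summit.AtomisticToContinuum.Crystallization.Theorems.FrustratedLawDichotomyStrainedPatchHomExteriorRay

open Literature.Analysis.ValidatedNumerics.Numerics
open Summit.AtomisticToContinuum.Crystallization.Theorems.ChargedEnergyGapNegative (E3)

/-! ## §1 Break points of a ray through a nested chain of closed sets -/

section General
variable {E : Type*} [NormedAddCommGroup E] [NormedSpace ℝ E]

/-- The parameter set of the ray `ξ₀ + s • (ξ − ξ₀)`, `s ∈ [0, 1]`, inside the set `B`. -/
def raySet (ξ₀ ξ : E) (B : Set E) : Set ℝ := Icc (0 : ℝ) 1 ∩ (fun s : ℝ => ξ₀ + s • (ξ - ξ₀)) ⁻¹' B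

/-- The ray's parameter set in a closed set is closed. [folklore] -/
theorem raySet_closed (ξ₀ ξ : E) {B : Set E} (hB : IsClosed B) : IsClosed (raySet ξ₀ ξ B) :=
  isClosed_Icc.inter (hB.preimage (by continuity))

/-- … bounded above by `1`. [formal bookkeeping] -/
theorem raySet_bdd (ξ₀ ξ : E) (B : Set E) : BddAbove (raySet ξ₀ ξ B) :=
  ⟨1, fun _ hs => hs.1.2⟩

/-- … contained in `[0, 1]`. [formal bookkeeping] -/
theorem raySet_subset_Icc (ξ₀ ξ : E) (B : Set E) : raySet ξ₀ ξ B ⊆ Icc 0 1 := fun _ hs => hs.1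

/-- … and contains `0` when the base point lies in `B`. [formal bookkeeping] -/
theorem zero_mem_raySet {ξ₀ ξ : E} {B : Set E} (h : ξ₀ ∈ B) : (0 : ℝ) ∈ raySet ξ₀ ξ B := by
  refine ⟨⟨le_rfl, zero_le_one⟩, ?_⟩
  simpa [raySet] using h

/-- ★ The exit parameter is ATTAINED: `sSup (raySet ξ₀ ξ B) ∈ raySet ξ₀ ξ B` for closed `B ∋ ξ₀`. [folklore: `IsClosed.csSup_mem`] -/
theorem sSup_raySet_mem {ξ₀ ξ : E} {B : Set E} (hB : IsClosed B) (h : ξ₀ ∈ B) : sSup (raySet ξ₀ ξ B) ∈ raySet ξ₀ ξ B :=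
  (raySet_closed ξ₀ ξ hB).csSup_mem ⟨0, zero_mem_raySet h⟩ (raySet_bdd ξ₀ ξ B)

/-- **THE BREAK POINTS** of the ray through the chain `B 0 ⊆ … ⊆ B (m−1)`: `θ 0 = 0`, `θ k = sSup (raySet ξ₀ ξ (B (k−1)))` (the exit parameter of `B (k−1)`) for
`1 ≤ k < m`, and `θ k = 1` for `m ≤ k`. -/
def exitParam (ξ₀ ξ : E) (B : ℕ → Set E) (m : ℕ) (k : ℕ) : ℝ :=
  if k = 0 then 0 else if m ≤ k then 1 else sSup (raySet ξ₀ ξ (B (k - 1)))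

/-- ★★ **BREAK POINTS EXIST FOR A NESTED CHAIN OF CLOSED SETS**: `B 0 ⊆ B 1 ⊆ … ⊆ B (m−1)` closed, `ξ₀ ∈ B 0`, `ξ ∈ B (m−1)` (`0 < m`) ⟹ there are `θ 0 = 0`, `θ m = 1`,
`θ k ≤ θ (k+1)` (`k < m`), all `θ k ∈ [0, 1]` (`k ≤ m`), and for every piece `k < m` BOTH ray points `ξ₀ + θ k·(ξ − ξ₀)`, `ξ₀ + θ (k+1)·(ξ − ξ₀)` lie in `B k` — the hypotheses
`hθ0 / hθm / hmono` of `hver_of_slabParts_pieces` and the two-ray-points-in-the-box hypothesis of `curvLJ_floorM_of_check` per piece. [folklore real analysis] -/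
theorem exists_exitChain {ξ₀ ξ : E} (B : ℕ → Set E) (m : ℕ) (hm : 0 < m) (hclosed : ∀ k, k < m → IsClosed (B k))
    (hnest : ∀ k, k + 1 < m → B k ⊆ B (k + 1)) (h0 : ξ₀ ∈ B 0) (h1 : ξ ∈ B (m - 1)) :
    ∃ θ : ℕ → ℝ, θ 0 = 0 ∧ θ m = 1 ∧ (∀ k, k < m → θ k ≤ θ (k + 1)) ∧ (∀ k, k ≤ m → θ k ∈ Icc (0 : ℝ) 1) ∧
      (∀ k, k < m → ξ₀ + θ k • (ξ - ξ₀) ∈ B k ∧ ξ₀ + θ (k + 1) • (ξ - ξ₀) ∈ B k) := by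
  -- ξ₀ lies in every box of the chain
  have hin : ∀ k, k < m → ξ₀ ∈ B k := by
    intro k
    induction k with
    | zero => intro _; exact h0
    | succ n ih => intro hk; exact hnest n hk (ih (by omega))
  set θ := exitParam ξ₀ ξ B m with hθ
  have hθ0 : θ 0 = 0 := by simp [hθ, exitParam]
  have hθtop : ∀ k, m ≤ k → θ k = 1 := by
    intro k hk
    have hk0 : k ≠ 0 := by omega
    simp [hθ, exitParam, hk0, hk]
  have hθmid : ∀ k, 1 ≤ k → k < m → θ k = sSup (raySet ξ₀ ξ (B (k - 1))) := by
    intro k hk1 hkm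
    have hk0 : k ≠ 0 := by omega
    have hkm' : ¬ m ≤ k := by omega
    simp [hθ, exitParam, hk0, hkm']
  -- the sup of each ray set is attained and lies in [0,1]
  have hsup : ∀ k, k < m → sSup (raySet ξ₀ ξ (B k)) ∈ raySet ξ₀ ξ (B k) := fun k hk =>
    sSup_raySet_mem (hclosed k hk) (hin k hk)
  refine ⟨θ, hθ0, hθtop m le_rfl, ?_, ?_, ?_⟩
  · -- monotone
    intro k hk
    by_cases hk0 : k = 0
    · subst hk0
      by_cases hm1 : m ≤ 1
      · rw [hθ0, hθtop 1 hm1]; exact zero_le_one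
      · rw [hθ0, hθmid 1 le_rfl (by omega)]
        exact (hsup 0 hm).1.1
    · by_cases hkm : m ≤ k + 1
      · rw [hθtop (k + 1) hkm, hθmid k (by omega) hk]
        exact (hsup (k - 1) (by omega)).1.2
      · rw [hθmid k (by omega) hk, hθmid (k + 1) (by omega) (by omega)]
        simp only [Nat.add_sub_cancel]
        apply csSup_le_csSup (raySet_bdd ξ₀ ξ _) ⟨0, zero_mem_raySet (hin (k - 1) (by omega))⟩
        intro s hs
        have hsub := hnest (k - 1) (by omega)
        have : k - 1 + 1 = k := by omega
        rw [this] at hsub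
        exact ⟨hs.1, hsub hs.2⟩
  · -- range
    intro k hk
    by_cases hk0 : k = 0
    · subst hk0; rw [hθ0]; exact ⟨le_rfl, zero_le_one⟩
    · by_cases hkm : m ≤ k
      · rw [hθtop k hkm]; exact ⟨zero_le_one, le_rfl⟩
      · rw [hθmid k (by omega) (by omega)]
        exact (hsup (k - 1) (by omega)).1
  · -- ray points in the boxes
    intro k hk
    constructor
    · by_cases hk0 : k = 0
      · subst hk0; rw [hθ0]; simpa using h0
      · rw [hθmid k (by omega) hk]
        have hmem := (hsup (k - 1) (by omega)).2
        simp only [mem_preimage] at hmem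
        have hsub := hnest (k - 1) (by omega)
        have : k - 1 + 1 = k := by omega
        rw [this] at hsub
        exact hsub hmem
    · by_cases hkm : m ≤ k + 1
      · rw [hθtop (k + 1) hkm]
        have : k = m - 1 := by omega
        subst this
        simpa using h1
      · rw [hθmid (k + 1) (by omega) (by omega)]
        simp only [Nat.add_sub_cancel]
        have hmem := (hsup k hk).2
        simpa only [mem_preimage] using hmem

end General

/-! ## §2 The kit's integer ξ-boxes: closedness, containment from integer endpoints, and the break points in the kit's hypothesis shape -/

/-- The ξ-box of an integer box `(c, w)` (shuffle coordinates `Sum.inr i`, scaled by `SC`): `{x : E3 | ∀ i, |x i − c (inr i)/SC| ≤ w (inr i)/SC}`. -/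
def xiBox (c w : (Fin 3 × Fin 3) ⊕ Fin 3 → ℤ) : Set E3 :=
  {x : E3 | ∀ i : Fin 3, |x i - (c (Sum.inr i) : ℝ) / SC| ≤ (w (Sum.inr i) : ℝ) / SC}

/-- Membership in `xiBox` is the kit's coordinate hypothesis. [formal bookkeeping] -/
theorem mem_xiBox {c w : (Fin 3 × Fin 3) ⊕ Fin 3 → ℤ} {x : E3} :
    x ∈ xiBox c w ↔ ∀ i : Fin 3, |x i - (c (Sum.inr i) : ℝ) / SC| ≤ (w (Sum.inr i) : ℝ) / SC := Iff.rfl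

/-- The ξ-box is closed. [folklore] -/
theorem isClosed_xiBox (c w : (Fin 3 × Fin 3) ⊕ Fin 3 → ℤ) : IsClosed (xiBox c w) := by
  have : xiBox c w = ⋂ i : Fin 3, {x : E3 | |x i - (c (Sum.inr i) : ℝ) / SC| ≤ (w (Sum.inr i) : ℝ) / SC} := by
    ext x; simp [xiBox]
  rw [this]
  refine isClosed_iInter fun i => ?_
  have hc : Continuous fun x : E3 => |x i - (c (Sum.inr i) : ℝ) / SC| :=
    ((EuclideanSpace.proj i).continuous.sub continuous_const).abs
  exact isClosed_le hc continuous_const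

/-- ★ **INTEGER ENDPOINT CONTAINMENT ⟹ SET CONTAINMENT** (the side condition a manifest / Bool verdict checks by `decide`). [arithmetic] -/
theorem xiBox_mono {c w c' w' : (Fin 3 × Fin 3) ⊕ Fin 3 → ℤ}
    (hcont : ∀ i : Fin 3, c' (Sum.inr i) - w' (Sum.inr i) ≤ c (Sum.inr i) - w (Sum.inr i) ∧
      c (Sum.inr i) + w (Sum.inr i) ≤ c' (Sum.inr i) + w' (Sum.inr i)) :
    xiBox c w ⊆ xiBox c' w' := by
  intro x hx i
  have hS : (0 : ℝ) < SC := SC_pos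
  have h := hx i
  rw [abs_sub_le_iff] at h ⊢
  obtain ⟨h1, h2⟩ := hcont i
  have e1 : ((c' (Sum.inr i) : ℝ) - w' (Sum.inr i)) / SC ≤ ((c (Sum.inr i) : ℝ) - w (Sum.inr i)) / SC := by
    apply div_le_div_of_nonneg_right _ hS.le
    exact_mod_cast h1
  have e2 : ((c (Sum.inr i) : ℝ) + w (Sum.inr i)) / SC ≤ ((c' (Sum.inr i) : ℝ) + w' (Sum.inr i)) / SC := by
    apply div_le_div_of_nonneg_right _ hS.le
    exact_mod_cast h2
  rw [sub_div] at e1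
  rw [sub_div] at e1
  rw [add_div, add_div] at e2
  constructor <;> linarith [h.1, h.2]

/-- ★★ **BREAK POINTS FOR A CHAIN OF INTEGER ξ-BOXES** `(cs k, ws k)`, `k < m`, nested by integer endpoint containment, the reference `ξ₀` in box `0` and the target `ξ` in box
`m − 1`: break points `θ` as in `hver_of_slabParts_pieces`, with both ray points of piece `k` inside box `k` IN THE COORDINATE SHAPE of `curvLJ_floorM_of_check`
(`hξ₀` / `hξ` there, at `c := cs k`, `w := ws k`). [folklore: `exists_exitChain` on `xiBox`] -/
theorem exists_exitChain_xiBox {ξ₀ ξ : E3} (cs ws : ℕ → ((Fin 3 × Fin 3) ⊕ Fin 3 → ℤ)) (m : ℕ) (hm : 0 < m)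
    (hnest : ∀ k, k + 1 < m → ∀ i : Fin 3, cs (k + 1) (Sum.inr i) - ws (k + 1) (Sum.inr i) ≤ cs k (Sum.inr i) - ws k (Sum.inr i) ∧
      cs k (Sum.inr i) + ws k (Sum.inr i) ≤ cs (k + 1) (Sum.inr i) + ws (k + 1) (Sum.inr i))
    (h0 : ∀ i : Fin 3, |ξ₀ i - (cs 0 (Sum.inr i) : ℝ) / SC| ≤ (ws 0 (Sum.inr i) : ℝ) / SC)
    (h1 : ∀ i : Fin 3, |ξ i - (cs (m - 1) (Sum.inr i) : ℝ) / SC| ≤ (ws (m - 1) (Sum.inr i) : ℝ) / SC) :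
    ∃ θ : ℕ → ℝ, θ 0 = 0 ∧ θ m = 1 ∧ (∀ k, k < m → θ k ≤ θ (k + 1)) ∧ (∀ k, k ≤ m → θ k ∈ Icc (0 : ℝ) 1) ∧
      (∀ k, k < m →
        (∀ i : Fin 3, |(ξ₀ + θ k • (ξ - ξ₀)) i - (cs k (Sum.inr i) : ℝ) / SC| ≤ (ws k (Sum.inr i) : ℝ) / SC) ∧
        (∀ i : Fin 3, |(ξ₀ + θ (k + 1) • (ξ - ξ₀)) i - (cs k (Sum.inr i) : ℝ) / SC| ≤ (ws k (Sum.inr i) : ℝ) / SC)) := by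
  obtain ⟨θ, hθ0, hθm, hmono, hrange, hpts⟩ := exists_exitChain (ξ₀ := ξ₀) (ξ := ξ) (fun k => xiBox (cs k) (ws k)) m hm
    (fun k _ => isClosed_xiBox _ _) (fun k hk => xiBox_mono (hnest k hk)) h0 h1
  exact ⟨θ, hθ0, hθm, hmono, hrange, fun k hk => ⟨(mem_xiBox).1 (hpts k hk).1, (mem_xiBox).1 (hpts k hk).2⟩⟩

/-- The ray points stay in the shuffle ball `‖·‖ ≤ 1/4` whenever both end points do (convexity of the ball; the `hn₀`/`hn` hypotheses of `curvLJ_floorM_of_check` along the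
chain). [folklore] -/
theorem norm_rayPoint_le {ξ₀ ξ : E3} (hξ₀ : ‖ξ₀‖ ≤ 1 / 4) (hξ : ‖ξ‖ ≤ 1 / 4) {s : ℝ} (hs : s ∈ Icc (0 : ℝ) 1) :
    ‖ξ₀ + s • (ξ - ξ₀)‖ ≤ 1 / 4 := by
  have hdec : ξ₀ + s • (ξ - ξ₀) = (1 - s) • ξ₀ + s • ξ := by
    rw [smul_sub, sub_smul, one_smul]; abel
  rw [hdec]
  calc ‖(1 - s) • ξ₀ + s • ξ‖ ≤ ‖(1 - s) • ξ₀‖ + ‖s • ξ‖ := norm_add_le _ _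
    _ = (1 - s) * ‖ξ₀‖ + s * ‖ξ‖ := by
        rw [norm_smul, norm_smul, Real.norm_of_nonneg (by linarith [hs.2]), Real.norm_of_nonneg hs.1]
    _ ≤ (1 - s) * (1 / 4) + s * (1 / 4) := by
        gcongr
        · linarith [hs.2]
        · exact hs.1
    _ = 1 / 4 := by ring

end Summit.AtomisticToContinuum.Crystallization.Theorems.FrustratedLawDichotomyStrainedPatchHomExteriorRay

end
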